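import Summits.Ventures.PackingBounds.Energy.NewtonCertificate

/-!
# Universal optimality of the Higman–Sims configuration (100 points on S²¹) — Cohn–Kumar 2007, Thm.
1.2, in LP-certificate form

Framing: lottery ticket; floor = certified bounds/negative ranges. Venture `PackingBounds` (cell
`pub-packcert`, seat `pub-packcert-energy`), energy-minimisation family, **universal + control**:
not one potential but ALL of them.

**Theorem A (`ckPow_energy_ge`, every `k : ℕ`).** Every configuration `C` of `100` unit vectors of
`ℝ^22` satisfies `Σ_{x ≠ y ∈ C} (1 + ⟨x,y⟩)^k ≥ 100 · Σ_i m_i (1 + t_i)^k` with `(t_i) = (-4 / 11, 1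
/ 11)`, `(m_i) = (22, 77)` — the right-hand side is the `(1+t)^k`-energy (ordered pairs) of the
Higman–Sims configuration (inner products -4/11, 1/11), whose inner products between distinct points
are the `t_i` with these multiplicities from each point (a spherical `3`-design; Cohn–Kumar 2007,
Table 1).

**Theorem B (`universally_optimal`).** For every potential `a` represented on `[-1,1)` by `a(s) =
Σ_k c_k (1+s)^k` with all `c_k ≥ 0` — by S. Bernstein's theorem these are exactly the functions
absolutely monotonic on `[-1,1)` (`C^∞`, all derivatives `≥ 0`), e.g. every inverse power law `a(t)
= (2-2t)^(-s/2) = |x-y|^(-s)`, `s > 0`, and every `(1+t)^k` — every such `C` has `Σ_{x ≠ y ∈ C}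
a(⟨x,y⟩) ≥ 100 · Σ_i m_i a(t_i)`, the `a`-energy of the configuration: the configuration minimises
every such energy among `100`-point configurations on `S^21` (universal optimality, loc. cit., Thm.
1.2; Bernstein's identification of the class is cited, not formalised, which is why the hypothesis
is stated as a power series).

Certificate (kernel-checked, exact rationals): node values `u = 1 + t ∈ (7 / 11, 12 / 11)` doubled
(second-order Hermite interpolation at every node, Cohn–Kumar §6); the Gegenbauer `C^(10)`
expansions of the `4` Newton partial products `∏_{i<j} (u - u_i)` have ALL coefficients `≥ 0` (the
table `G` below — Cohn–Kumar's conductivity of `F²`), and the design identities `100 G_{j,0} =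
ω_j(2) + Σ_i m_i ω_j(u_i)`, `j < 4`, hold; the generic theorem `NewtonCert.energy_ge`
(`NewtonCertificate.lean`: Newton division of `u^k` with nonnegative coefficients and remainder,
then the LP bound `EnergyLP.energy_ge_inner` of Yudin / Cohn–Kumar Prop. 4.1) does the rest for
every `k` at once, and `NewtonCert.energy_ge_hasSum_of_pow` sums over `k`. Data generated and
re-checked in exact arithmetic by the cell's `code/ck_newton.py` / `code/emit_universal.py`
(pub-packcert-energy).

## References
* H. Cohn, A. Kumar, *Universally optimal distribution of points on spheres*, J. Amer. Math. Soc.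
  20 (2007) 99–148, Thm. 1.2, Table 1, Prop. 4.1, §§5–6. [`CohnKumar2006`]
* S. Bernstein, *Sur les fonctions absolument monotones*, Acta Math. 52 (1929) 1–66; D. V. Widder,
  *The Laplace Transform* (1941), Ch. IV (the classical identification of the potential class). -/

noncomputable section

namespace Summit.Ventures.PackingBounds.Energy

open Finset Literature.Analysis.SpecialFunctions Literature.Geometry.DiscreteGeometry

namespace UniversalDim22Card100

/-- Explicit form of the Gegenbauer polynomial `C_0^(10)` of the tree. [folklore] -/
private theorem c10_0 (t : ℝ) : gegenbauerSum (10 : ℝ) 0 t =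
    (1 : ℝ) := by
  simp [gegenbauerSum, gegenbauerCoeff]

/-- Explicit form of the Gegenbauer polynomial `C_1^(10)` of the tree. [folklore] -/
private theorem c10_1 (t : ℝ) : gegenbauerSum (10 : ℝ) 1 t =
    (20 : ℝ) * t := by
  rw [gegenbauerSum_one]
  ring

/-- Explicit form of the Gegenbauer polynomial `C_2^(10)` of the tree. [folklore] -/
private theorem c10_2 (t : ℝ) : gegenbauerSum (10 : ℝ) 2 t =
    (-10 : ℝ) + (220 : ℝ) * t ^ 2 := by
  simp [gegenbauerSum, gegenbauerCoeff, Finset.sum_range_succ, Finset.prod_range_succ,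
    Nat.factorial]
  ring

/-- Explicit form of the Gegenbauer polynomial `C_3^(10)` of the tree. [folklore] -/
private theorem c10_3 (t : ℝ) : gegenbauerSum (10 : ℝ) 3 t =
    (-220 : ℝ) * t + (1760 : ℝ) * t ^ 3 := by
  simp [gegenbauerSum, gegenbauerCoeff, Finset.sum_range_succ, Finset.prod_range_succ,
    Nat.factorial]
  ring

open scoped Classical in
/-- **Theorem A.** For every `k`, every `100`-point configuration of unit vectors in `ℝ^22` has `(1
+ ⟨x,y⟩)^k`-energy at least that of the Higman–Sims configuration (100 points on S²¹): `Σ_{x ≠ y} (1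
+ ⟨x,y⟩)^k ≥ 100 Σ_i m_i (1 + t_i)^k`, `(t_i) = (-4 / 11, 1 / 11)`, `(m_i) = (22, 77)`. Newton-form
certificate (node values, Gegenbauer table `G ≥ 0` of the partial products, design identities)
checked by the kernel in exact rational arithmetic. [cite: CohnKumar2006, Theorem 1.2, Table 1 and
§6] -/
theorem ckPow_energy_ge (k : ℕ) (C : Finset (EuclideanSpace ℝ (Fin 22)))
    (h1 : ∀ x ∈ C, ‖x‖ = 1) (hN : C.card = 100) :
    (100 : ℝ) * (22 * (1 + (-4 / 11 : ℝ)) ^ k + 77 * (1 + (1 / 11 : ℝ)) ^ k) ≤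
      ∑ x ∈ C, ∑ y ∈ C.erase x, (1 + inner ℝ x y) ^ k := by
  refine le_trans (le_of_eq ?val) (NewtonCert.energy_ge (n := 22) (μ := 10) (by norm_num)
    (by norm_num) 4 (by norm_num)
    -- node values u_i = 1 + t_i (doubled sequence)
    (fun i : ℕ => match i with
      | 0 => (7 / 11 : ℝ) | 1 => 12 / 11 | 2 => 7 / 11 | 3 => 12 / 11 | _ => 0)
    ?hv ?hsq
    -- Gegenbauer C^(10) expansion table of the 4 Newton partial products (row j, column i)
    (fun j i : ℕ => match j with
      | 0 => (match i with | 0 => (1 : ℝ) | _ => 0)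
      | 1 => (match i with | 0 => (4 / 11 : ℝ) | 1 => 1 / 20 | _ => 0)
      | 2 => (match i with | 0 => (3 / 242 : ℝ) | 1 => 3 / 220 | 2 => 1 / 220 | _ => 0)
      | 3 => (match i with
          | 0 => (45 / 2662 : ℝ) | 1 => 37 / 3872 | 2 => 7 / 2420 | 3 => 1 / 1760 | _ => 0)
      | _ => 0)
    ?hG ?hGid 100 2 (by norm_num)
    -- distance distribution m_i
    (fun i : ℕ => match i with | 0 => (22 : ℝ) | 1 => 77 | _ => 0)
    ?hdes k C h1 hN)
  case hv => intro i; split <;> norm_num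
  case hsq =>
    exact fun u _ => NewtonCert.omega_doubled_nonneg _ 2 (fun i hi => by
      interval_cases i <;> norm_num) u
  case hG =>
    intro j i
    split <;> (first | (split <;> norm_num) | norm_num)
  case hGid =>
    intro j hj t
    interval_cases j
    · simp only [Finset.prod_range_zero, Finset.sum_range_succ, Finset.sum_range_zero,
        c10_0, c10_1, c10_2, c10_3]
      ring
    · simp only [Finset.prod_range_succ, Finset.prod_range_zero, Finset.sum_range_succ,
        Finset.sum_range_zero, c10_0, c10_1, c10_2, c10_3]
      ring
    · simp only [Finset.prod_range_succ, Finset.prod_range_zero, Finset.sum_range_succ,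
        Finset.sum_range_zero, c10_0, c10_1, c10_2, c10_3]
      ring
    · simp only [Finset.prod_range_succ, Finset.prod_range_zero, Finset.sum_range_succ,
        Finset.sum_range_zero, c10_0, c10_1, c10_2, c10_3]
      ring
  case hdes =>
    intro j hj
    interval_cases j <;> norm_num [Finset.prod_range_succ, Finset.prod_range_zero,
      Finset.sum_range_succ, Finset.sum_range_zero]
  case val => norm_num [Finset.sum_range_succ, Finset.sum_range_zero]

open scoped Classical in
/-- **Theorem B (universal optimality, Cohn–Kumar Thm. 1.2 for this configuration).** For every
potential `a` with `a(s) = Σ_k c_k (1+s)^k`, `c_k ≥ 0`, on `[-1,1)` (≡ absolutely monotonic on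
`[-1,1)` by Bernstein's theorem), every `100`-point configuration of unit vectors in `ℝ^22` has
`a`-energy `Σ_{x ≠ y} a(⟨x,y⟩) ≥ 100 Σ_i m_i a(t_i)`, the `a`-energy of the Higman–Sims
configuration (100 points on S²¹). [cite: CohnKumar2006, Theorem 1.2] -/
theorem universally_optimal (a : ℝ → ℝ) (c : ℕ → ℝ) (hc : ∀ k, 0 ≤ c k)
    (ha : ∀ s : ℝ, -1 ≤ s → s < 1 → HasSum (fun k => c k * (1 + s) ^ k) (a s))
    (C : Finset (EuclideanSpace ℝ (Fin 22))) (h1 : ∀ x ∈ C, ‖x‖ = 1) (hN : C.card = 100) :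
    (100 : ℝ) * (22 * a (-4 / 11) + 77 * a (1 / 11)) ≤
      ∑ x ∈ C, ∑ y ∈ C.erase x, a (inner ℝ x y) := by
  have key := NewtonCert.energy_ge_hasSum_of_pow (n := 22) 100 2
    (fun i : ℕ => match i with | 0 => (-4 / 11 : ℝ) | 1 => 1 / 11 | _ => 0)
    (fun i : ℕ => match i with | 0 => (22 : ℝ) | 1 => 77 | _ => 0)
    (fun i hi => by interval_cases i <;> norm_num) C h1
    (fun k => by
      have h := ckPow_energy_ge k C h1 hN
      norm_num [Finset.sum_range_succ, Finset.sum_range_zero] at h ⊢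
      exact h)
    a c hc ha
  norm_num [Finset.sum_range_succ, Finset.sum_range_zero] at key ⊢
  exact key

end UniversalDim22Card100

end Summit.Ventures.PackingBounds.Energy

end
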